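import Summits.BirchSwinnertonDyer.Rank1Residual.X12.O11.RouteUPrimeMember
import Summits.BirchSwinnertonDyer.Rank1Residual.X12.O11.RouteUEulerCriterionNat
import HarnessLib

/-!
# ROUTE U, prime member `D = −191` (curve `49a1^{(−191)}`, `N = 49·191² = 1787569`, beyond the N < 5·10⁵ census window), Heegner field
# `K'' = ℚ(√−47)`: the two Bernoulli-unit certificates, BSD₇ and FULL BSD by the prime-member class theorem

bsd-cm cell (run/shared/lean/pub/bsd-cm/), ROUTE U, seat `bsd-cm-ram` (g6). Instance of
`RouteU.bsdp_seven_of_twist_cm7_prime` at `(q, r) = (191, 47)`: `191 ≡ 47 ≡ 3 (mod 4)`, `(−47/7) = (−47/191) = 1`.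
`W ∈ 𝒞₇` since `(−7/191) = 1`, so the FULL-BSD corollary `forall_bsdp_of_twist_cm7_D191` (`forall_bsdp_of_twist_cm7_prime`) is drawn as well.
Fact-free: no `Fact (Nat.Prime _)` instance is declared (the class theorem's instances are passed as
`⟨by norm_num⟩`; the certificates are stated with Jacobi symbols `J(j | 191)` and bridged to the class theorem's
`legendreSym 191` under the binder by `jacobiSym.legendreSym.to_jacobiSym`). The per-member inputs are the two kernel
certificates (`decide +kernel` with Euler's criterion in `ℕ`-arithmetic, `RouteUEulerCriterionNat.jacobiSym_prime_eq_ite_nat`;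
mod-`49` sums of lengths `1337` and `62839`, the second in 4 blocks of ≤ 20000 terms):
* `norm_generalizedBernoulli_theta1_D191` — `‖B_{1,ω⁴χ_{−191}}‖₇ = 1`;
* `norm_generalizedBernoulli_theta2_D191` — `‖B_{1,ωχ_{−191}χ_{−47}}‖₇ = 1`;
* **`bsdp_seven_of_twist_cm7_D191`** — BSD₇ for every globally minimal model of `49a1^{(−191)}` with `r_an = 1`,
  from the class theorem (named facts: Kriz–Li Thm 1.20 / Rem 3.10, Gross–Zagier, Kolyvagin, GZK, modularity,
  Rubin 1983 Thm C, Burungale–Flach 2024, Buhler–Gross 1985 Ch. II; displayed data: Heegner datum over `ℚ(√−47)`,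
  a Mordell–Weil coordinate over `K`, `L(W^{(−47)},1) ≠ 0`, the twin's minimal model, `7 ∤ c` (Manin constant));
* **`forall_bsdp_of_twist_cm7_D191`** — FULL BSD (Miller's `BSD(E,p)` at every prime) for the same curves.
THEOREMS ONLY; nothing booked. References: [KrizLi2019] Thm. 1.20; [Washington1997] §5.1, Thm 4.2;
[Rubin1983] Thm C; [BuhlerGross1985] Ch. II; [BurungaleFlach2024] Thm 1.1; [Miller2011LMS] Def. 1.1.
-/

noncomputable section

open scoped Classical NumberTheorySymbols
open NumberField WeierstrassCurve DirichletCharacter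
open Literature.NumberTheory.EllipticCurves Literature.NumberTheory.EllipticCurves.Rank1Residual
open Literature.NumberTheory.EllipticCurves.KrizLi2019 Literature.NumberTheory.LFunctions
open Literature.NumberTheory.EllipticCurves.ModularForms

namespace Summit.BirchSwinnertonDyer.Rank1Residual.X12.O11.RouteU

/-- `ord₇ (7·191) = 1`. [folklore] -/
theorem padicValNat_seven_level1_D191 : padicValNat 7 (7 * 191) = 1 := by
  rw [padicValNat.mul (by norm_num) (by norm_num), padicValNat_self, padicValNat.eq_zero_of_not_dvd (by norm_num)]

/-- `ord₇ (7·191·47) = 1`. [folklore] -/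
theorem padicValNat_seven_level2_D191 : padicValNat 7 (7 * 191 * 47) = 1 := by
  rw [show (7 * 191 * 47 : ℕ) = 7 * (191 * 47) by norm_num, padicValNat.mul (by norm_num) (by norm_num),
    padicValNat_self, padicValNat.eq_zero_of_not_dvd (by norm_num)]

set_option maxRecDepth 400000 in
/-- **`‖B_{1,θ₁}‖₇ = 1`** for every character `θ₁` mod `7·191` with values `(j/191)·ω(j)⁴`, `ω`
Teichmüller (certificate `7 ∥ Σ_{j<1337} (j/191) j²⁹`, `decide +kernel`).
[cite: KrizLi2019, Thm. 1.20 (p. 8) and §1.5 (1)] [cite: Washington1997, §5.1 and Thm. 4.2] -/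
theorem norm_generalizedBernoulli_theta1_D191 (ω : DirichletCharacter ℚ_[7] 7)
    (hω : IsTeichmullerCharacter ω) (θ : DirichletCharacter ℚ_[7] (7 * 191))
    (hθ : ∀ j : ZMod (7 * 191), θ j = (J((j.val : ℤ) | 191) : ℚ_[7]) * ω (j.val : ZMod 7) ^ 4) :
    ‖generalizedBernoulli 1 θ‖ = 1 := by
  have hθ1 : θ ≠ 1 := by
    intro h1
    have hv := hθ (((1336 : ℕ)) : ZMod (7 * 191))
    have hval : (((1336 : ℕ) : ZMod (7 * 191))).val = 1336 := by
      rw [ZMod.val_natCast]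
    have h6 : (((1336 : ℕ)) : ZMod 7) = ((6 : ℕ) : ZMod 7) := by decide
    have hu : IsUnit (((1336 : ℕ)) : ZMod (7 * 191)) := by
      rw [ZMod.isUnit_iff_coprime]; norm_num
    rw [h1, hval, MulChar.one_apply hu, h6, apply_neg_one_pow_four, mul_one] at hv
    have hL : J(((1336 : ℕ) : ℤ) | 191) = -1 := by
      rw [jacobiSym_prime_eq_ite_nat 191 (by norm_num) (by norm_num)]; decide
    rw [hL] at hv
    norm_num at hv
  refine norm_generalizedBernoulli_one_eq_one_of_cert_range θ hθ1 padicValNat_seven_level1_D191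
    (fun j => J((j : ℤ) | 191)) 28 (fun j => ?_) (-51516234310298550515262116508523601906580320605774944987545539023150377676637737848779670021) ?_ (by norm_num) (by norm_num)
  · have := norm_sub_le_of_values ω hω θ (fun j => J((j : ℤ) | 191)) 4 (by norm_num) hθ j
    simpa using this
  · simp_rw [jacobiSym_prime_eq_ite_nat 191 (by norm_num) (by norm_num)]; decide +kernel

set_option maxRecDepth 400000 in
/-- Block 0 of the `θ₂` certificate for `D = −191`: `Σ_{0 ≤ j < 20000} (j/191)(j/47) j⁸` evaluated (`decide +kernel`). [folklore] -/
theorem theta2_D191_block0 :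
    ∑ j ∈ Finset.Ico (0 : ℕ) 20000,
      (J((j : ℤ) | 191) * J((j : ℤ) | 47)) * (j : ℤ) ^ (7 + 1) = (119543100582556169077566440258170082) := by
  simp_rw [jacobiSym_prime_eq_ite_nat 191 (by norm_num) (by norm_num), jacobiSym_prime_eq_ite_nat 47 (by norm_num) (by norm_num)]
  decide +kernel

set_option maxRecDepth 400000 in
/-- Block 1 of the `θ₂` certificate for `D = −191`: `Σ_{20000 ≤ j < 40000} (j/191)(j/47) j⁸` evaluated (`decide +kernel`). [folklore] -/
theorem theta2_D191_block1 :
    ∑ j ∈ Finset.Ico (20000 : ℕ) 40000,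
      (J((j : ℤ) | 191) * J((j : ℤ) | 47)) * (j : ℤ) ^ (7 + 1) = (-77500192838400044129387126148385923189) := by
  simp_rw [jacobiSym_prime_eq_ite_nat 191 (by norm_num) (by norm_num), jacobiSym_prime_eq_ite_nat 47 (by norm_num) (by norm_num)]
  decide +kernel

set_option maxRecDepth 400000 in
/-- Block 2 of the `θ₂` certificate for `D = −191`: `Σ_{40000 ≤ j < 60000} (j/191)(j/47) j⁸` evaluated (`decide +kernel`). [folklore] -/
theorem theta2_D191_block2 :
    ∑ j ∈ Finset.Ico (40000 : ℕ) 60000,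
      (J((j : ℤ) | 191) * J((j : ℤ) | 47)) * (j : ℤ) ^ (7 + 1) = (-1708211496070266061989303978211743652585) := by
  simp_rw [jacobiSym_prime_eq_ite_nat 191 (by norm_num) (by norm_num), jacobiSym_prime_eq_ite_nat 47 (by norm_num) (by norm_num)]
  decide +kernel

set_option maxRecDepth 400000 in
/-- Block 3 of the `θ₂` certificate for `D = −191`: `Σ_{60000 ≤ j < 62839} (j/191)(j/47) j⁸` evaluated (`decide +kernel`). [folklore] -/
theorem theta2_D191_block3 :
    ∑ j ∈ Finset.Ico (60000 : ℕ) (7 * 191 * 47),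
      (J((j : ℤ) | 191) * J((j : ℤ) | 47)) * (j : ℤ) ^ (7 + 1) = (3654667782651166956898089700890695806972) := by
  simp_rw [jacobiSym_prime_eq_ite_nat 191 (by norm_num) (by norm_num), jacobiSym_prime_eq_ite_nat 47 (by norm_num) (by norm_num)]
  decide +kernel

/-- The `θ₂` certificate sum for `D = −191` assembled from its blocks, `7 ∥ S₂`. [folklore] -/
theorem theta2_D191_sum :
    ∑ j ∈ Finset.range (7 * 191 * 47),
      (J((j : ℤ) | 191) * J((j : ℤ) | 47)) * (j : ℤ) ^ (7 + 1) = (1869075636843083406948476162970824401280) := by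
  rw [Finset.range_eq_Ico, ← Finset.sum_Ico_consecutive _ (show 0 ≤ 20000 by norm_num) (show 20000 ≤ 7 * 191 * 47 by norm_num),
    ← Finset.sum_Ico_consecutive _ (show 20000 ≤ 40000 by norm_num) (show 40000 ≤ 7 * 191 * 47 by norm_num),
    ← Finset.sum_Ico_consecutive _ (show 40000 ≤ 60000 by norm_num) (show 60000 ≤ 7 * 191 * 47 by norm_num),
    theta2_D191_block0, theta2_D191_block1, theta2_D191_block2, theta2_D191_block3]
  norm_num

set_option maxRecDepth 400000 in
/-- **`‖B_{1,θ₂}‖₇ = 1`** for every character `θ₂` mod `7·191·47` with values `(j/191)·(j/47)·ω(j)`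
(certificate `7 ∥ Σ_{j<62839} (j/191)(j/47) j⁸`, `decide +kernel`).
[cite: KrizLi2019, Thm. 1.20 (p. 8) and §1.5 (1)] [cite: Washington1997, §5.1 and Thm. 4.2] -/
theorem norm_generalizedBernoulli_theta2_D191 (ω : DirichletCharacter ℚ_[7] 7)
    (hω : IsTeichmullerCharacter ω) (θ : DirichletCharacter ℚ_[7] (7 * 191 * 47))
    (hθ : ∀ j : ZMod (7 * 191 * 47), θ j =
      ((J((j.val : ℤ) | 191) * J((j.val : ℤ) | 47) : ℤ) : ℚ_[7]) * ω (j.val : ZMod 7) ^ 1) :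
    ‖generalizedBernoulli 1 θ‖ = 1 := by
  have hθ1 : θ ≠ 1 := by
    intro h1
    have hv := hθ (((62838 : ℕ)) : ZMod (7 * 191 * 47))
    have hval : (((62838 : ℕ) : ZMod (7 * 191 * 47))).val = 62838 := by
      rw [ZMod.val_natCast]
    have hu : IsUnit (((62838 : ℕ)) : ZMod (7 * 191 * 47)) := by
      rw [ZMod.isUnit_iff_coprime]; norm_num
    rw [h1, hval, MulChar.one_apply hu, pow_one] at hv
    have hL : (J(((62838 : ℕ) : ℤ) | 191) * J(((62838 : ℕ) : ℤ) | 47)) = 1 := by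
      rw [jacobiSym_prime_eq_ite_nat 191 (by norm_num) (by norm_num), jacobiSym_prime_eq_ite_nat 47 (by norm_num) (by norm_num)]; decide
    rw [hL, Int.cast_one, one_mul] at hv
    -- `ω(−1) = 1` contradicts `‖ω(6) − 6‖ < 1`
    have h6 : (((62838 : ℕ)) : ZMod 7) = ((6 : ℤ) : ZMod 7) := by decide
    rw [h6] at hv
    have hT := hω 6 (by decide)
    rw [← hv] at hT
    have : ‖(1 : ℚ_[7]) - ((6 : ℤ) : ℚ_[7])‖ = 1 := by
      rw [show (1 : ℚ_[7]) - ((6 : ℤ) : ℚ_[7]) = -((5 : ℕ) : ℚ_[7]) by norm_num, norm_neg]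
      exact Padic.norm_natCast_eq_one_iff.mpr (by decide)
    rw [this] at hT
    exact lt_irrefl _ hT
  refine norm_generalizedBernoulli_one_eq_one_of_cert_range θ hθ1 padicValNat_seven_level2_D191
    (fun j => J((j : ℤ) | 191) * J((j : ℤ) | 47)) 7 (fun j => ?_) (1869075636843083406948476162970824401280)
    theta2_D191_sum (by norm_num) (by norm_num)
  have := norm_sub_le_of_values ω hω θ (fun j => J((j : ℤ) | 191) * J((j : ℤ) | 47)) 1 le_rfl hθ j
  simpa using this

set_option maxRecDepth 400000 in
/-- **ROUTE U, member `D = −191` (`49a1^{(−191)}`, `N = 49·191² = 1787569`): BSD₇ for every globally minimal model of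
`49a1^{(−191)}` with `r_an = 1`**, by the prime-member class theorem at `(q, r) = (191, 47)` with the two
certificates above; the descent inputs (no `7`-torsion over `K`, `7 ∤ #Ш(W)`) are discharged inside the
class theorem (Mazur's local step; Buhler–Gross 1985 Ch. II BY NAME, binder `hBG`).
[cite: KrizLi2019, Thm. 1.20 and Rem. 3.10] [cite: Rubin1983, §0 Thm. C (p. 341)]
[cite: BurungaleFlach2024, Thm 1.1 and Cor. 2] [cite: GrossZagier1986, I.(6.5) and V.(2.1)]
[cite: Miller2011LMS, Thm. 2.5 and (5.1)] [cite: BuhlerGross1985, Ch. II (7.2)(2), (8.3)(1), (9.1) (pp. 16–18)] -/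
theorem bsdp_seven_of_twist_cm7_D191
    (hKL : KrizLi2019.thm120_padicLogHeegner_unit_of_bernoulli)
    (hRem : KrizLi2019.rem310_padicLogHeegner_integral)
    (W : WeierstrassCurve ℚ) [W.IsElliptic] [W.IsGloballyMinimal] [NeZero (W.conductorNorm ℤ)]
    (hW : ∃ C : VariableChange ℚ, C • W = cm7.quadraticTwist ((-(191 : ℕ) : ℤ) : ℚ))
    (K : Type) [Field K] [NumberField K] [NeZero (NumberField.discr K).natAbs]
    (hK : IsImaginaryQuadratic K) (hdK : NumberField.discr K = -(47 : ℕ))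
    (D : ModularParametrizationData W (W.conductorNorm ℤ))
    (H : HeegnerDatum (W.conductorNorm ℤ) (NumberField.discr K)) (ι : K →+* ℂ) (ιp : K →+* ℚ_[7])
    (P : (W.baseChange K).toAffine.Point)
    (hGZ : gross_zagier (W.conductorNorm ℤ) W K) (hKo : kolyvagin (W.conductorNorm ℤ) W K)
    (hGZK : rank_eq_analyticRank_of_analyticRank_le_one) (hmod : hasEntireLFunction_rat)
    (hP : WeierstrassCurve.Affine.Point.map ι.toRatAlgHom P = heegnerPointComplex D H)
    (hr1 : W.analyticRank = 1)
    (hLt : (W.quadraticTwist (NumberField.discr K : ℚ)).entireLFunction 1 ≠ 0)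
    (Wd : WeierstrassCurve ℚ) [Wd.IsElliptic] [Wd.IsGloballyMinimal] (Cd : VariableChange ℚ)
    (hWd : Cd • W.quadraticTwist (NumberField.discr K : ℚ) = Wd)
    (hBF : bsdTriple_of_hasCM_of_L_one_ne_zero)
    (hu : padicValRat 7 (Cd.u : ℚ) = 0)
    (hC : Rubin1983.thmC_seven_quadraticField)
    (hBG : BuhlerGross1985.firstDescent_seven_oddTwist_of_bernoulli)
    [Finite (AddCommGroup.torsion (W.baseChange K).toAffine.Point)]
    (crd : (W.baseChange K).toAffine.Point →+ ℤ) (g : (W.baseChange K).toAffine.Point)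
    (hg : crd g = 1) (hker : ∀ x, crd x = 0 → IsOfFinAddOrder x)
    (hc7 : ¬ ((7 : ℤ) ∣ D.c)) :
    BSDp W 7 :=
  bsdp_seven_of_twist_cm7_prime (q := 191) (r := 47) (hq := ⟨by norm_num⟩) (hr := ⟨by norm_num⟩)
    (by norm_num) (by norm_num) (by norm_num) (by norm_num) (by norm_num) (by norm_num)
    (by rw [legendreSym_eq_ite 7 (by norm_num)]; decide)
    (by rw [jacobiSym.legendreSym.to_jacobiSym, jacobiSym_prime_eq_ite 191 (by norm_num) (by norm_num)]; decide)
    (fun ω hω θ hθ => norm_generalizedBernoulli_theta1_D191 ω hω θ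
      (fun j => by rw [hθ j, jacobiSym.legendreSym.to_jacobiSym]))
    (fun ω hω θ hθ => norm_generalizedBernoulli_theta2_D191 ω hω θ
      (fun j => by rw [hθ j, jacobiSym.legendreSym.to_jacobiSym]))
    hKL hRem W hW K hK hdK D H ι ιp P hGZ hKo hGZK hmod hP hr1 hLt Wd Cd hWd hBF hu hC hBG crd g hg
    hker hc7

set_option maxRecDepth 400000 in
/-- **ROUTE U, member `D = −191`: FULL BSD** (Miller's `BSD(E,p)` at EVERY prime `p`) for every globally minimal model of
`49a1^{(−191)}` with `r_an = 1` (`W ∈ 𝒞₇` since `(−7/191) = 1`), by `forall_bsdp_of_twist_cm7_prime` at `(q, r) = (191, 47)`: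
BSD₇ from the two certificates above, BSD_p for `p ≠ 7` from the 𝒞₇ assembly `ClassCSeven.forall_bsdp_iff_bsdp_seven`
(named facts Li–Liu–Tian 2024, Kobayashi 2013, Li–Tian–Yan–Zhu 2025, Burungale–Flach 2024, modularity).
[cite: Miller2011LMS, §1 and Def. 1.1 (arXiv:1010.2431 p. 3)] [cite: KrizLi2019, Thm. 1.20 and Rem. 3.10] -/
theorem forall_bsdp_of_twist_cm7_D191
    (hKL : KrizLi2019.thm120_padicLogHeegner_unit_of_bernoulli)
    (hRem : KrizLi2019.rem310_padicLogHeegner_integral)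
    (W : WeierstrassCurve ℚ) [W.IsElliptic] [W.IsGloballyMinimal] [NeZero (W.conductorNorm ℤ)]
    (hW : ∃ C : VariableChange ℚ, C • W = cm7.quadraticTwist ((-(191 : ℕ) : ℤ) : ℚ))
    (K : Type) [Field K] [NumberField K] [NeZero (NumberField.discr K).natAbs]
    (hK : IsImaginaryQuadratic K) (hdK : NumberField.discr K = -(47 : ℕ))
    (D : ModularParametrizationData W (W.conductorNorm ℤ))
    (H : HeegnerDatum (W.conductorNorm ℤ) (NumberField.discr K)) (ι : K →+* ℂ) (ιp : K →+* ℚ_[7])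
    (P : (W.baseChange K).toAffine.Point)
    (hGZ : gross_zagier (W.conductorNorm ℤ) W K) (hKo : kolyvagin (W.conductorNorm ℤ) W K)
    (hGZK : rank_eq_analyticRank_of_analyticRank_le_one) (hmod : hasEntireLFunction_rat)
    (hP : WeierstrassCurve.Affine.Point.map ι.toRatAlgHom P = heegnerPointComplex D H)
    (hr1 : W.analyticRank = 1)
    (hLt : (W.quadraticTwist (NumberField.discr K : ℚ)).entireLFunction 1 ≠ 0)
    (Wd : WeierstrassCurve ℚ) [Wd.IsElliptic] [Wd.IsGloballyMinimal] (Cd : VariableChange ℚ)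
    (hWd : Cd • W.quadraticTwist (NumberField.discr K : ℚ) = Wd)
    (hBF : bsdTriple_of_hasCM_of_L_one_ne_zero)
    (hu : padicValRat 7 (Cd.u : ℚ) = 0)
    (hC : Rubin1983.thmC_seven_quadraticField)
    (hBG : BuhlerGross1985.firstDescent_seven_oddTwist_of_bernoulli)
    [Finite (AddCommGroup.torsion (W.baseChange K).toAffine.Point)]
    (crd : (W.baseChange K).toAffine.Point →+ ℤ) (g : (W.baseChange K).toAffine.Point)
    (hg : crd g = 1) (hker : ∀ x, crd x = 0 → IsOfFinAddOrder x)
    (hc7 : ¬ ((7 : ℤ) ∣ D.c)) (hLLT : LiLiuTian2024.thm11_bsdp_of_cm_rank_one)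
    (hKob : Kobayashi2013.cor14_bsdp_of_cm_rank_one) (hLTYZ : LiTianYanZhu2025.thm11_bsdp_of_cm_rank_one) :
    ∀ p : ℕ, p.Prime → BSDp W p :=
  forall_bsdp_of_twist_cm7_prime (q := 191) (r := 47) (hq := ⟨by norm_num⟩) (hr := ⟨by norm_num⟩)
    (by norm_num) (by norm_num) (by norm_num) (by norm_num) (by norm_num) (by norm_num)
    (by rw [legendreSym_eq_ite 7 (by norm_num)]; decide)
    (by rw [jacobiSym.legendreSym.to_jacobiSym, jacobiSym_prime_eq_ite 191 (by norm_num) (by norm_num)]; decide)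
    (by rw [jacobiSym.legendreSym.to_jacobiSym, jacobiSym_prime_eq_ite 191 (by norm_num) (by norm_num)]; decide)
    (fun ω hω θ hθ => norm_generalizedBernoulli_theta1_D191 ω hω θ
      (fun j => by rw [hθ j, jacobiSym.legendreSym.to_jacobiSym]))
    (fun ω hω θ hθ => norm_generalizedBernoulli_theta2_D191 ω hω θ
      (fun j => by rw [hθ j, jacobiSym.legendreSym.to_jacobiSym]))
    hKL hRem W hW K hK hdK D H ι ιp P hGZ hKo hGZK hmod hP hr1 hLt Wd Cd hWd hBF hu hC hBG crd g hg
    hker hc7 hLLT hKob hLTYZ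

end Summit.BirchSwinnertonDyer.Rank1Residual.X12.O11.RouteU

end
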